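import Summits.QuantumFields.YangMills.Theorems.AllWindowsColdBoxBoxHighLineCum3TriangleBound
import Summits.QuantumFields.YangMills.Theorems.AllWindowsColdBoxBoxHighLineGhostKernelEntries

/-!
# `ConnectedThreePoint` bound, the two quadratic vertices of `U_even` BY NAME (U5-BLOCKERS §2, lift L2): the ghost form `quadVal M_H` and the
# Haar/mass form `quadVal (m·1)`

Width seat `ym-line-sfw-p2-w3` (g41), cell ym-idea-1; U5 prep, helper-grade.  Instances of ✓`Cum3Triangle.abs_gaussCum3_linCurvSq_linCurvSq_quadVal_le`
(`|κ₃⁰(L_p, L_q, Q_M)| ≤ β⁻³·C·C_M·(1+log H)⁵/(1+‖p−q‖₁)⁴` for a symmetric vertex kernel `|M i j| ≤ C_M/(1+d_∞)⁴`):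

* ★ `abs_gaussCum3_linCurvSq_linCurvSq_ghostM_le` — the GHOST vertex `M = GhostFP.ghostM H` (symmetric ✓`GhostFP.ghostM_symm`, kernel decay
  ✓`GhostFP.abs_ghostM_le`): `|κ₃⁰(L_p, L_q, quadVal M_H)| ≤ β⁻³·C·(1+log H)⁵/(1+‖p−q‖₁)⁴`;
* ★ `abs_gaussCum3_linCurvSq_linCurvSq_quadVal_smul_one_le` — a MASS vertex `M = m·1` (the quadratic part `−Σ_e‖a_e‖²/12` of the Haar density,
  `m = −1/12`; any scalar multiple of the identity is a diagonal kernel): `|κ₃⁰(L_p, L_q, quadVal (m·1))| ≤ β⁻³·C·|m|·(1+log H)⁵/(1+‖p−q‖₁)⁴`.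
RELATIVE to the main term `≍ T⁻⁸` both are `T⁴·polylog/β ≤ H⁴·polylog/β` (4θ < 1), replacing blocker B2's Cauchy–Schwarz `H¹²/β` for these two vertices.

Tree only; no definitions; standard axioms.  HONEST LABEL: a tool for the RECORDED lift L2 of the NEXT rung U5 (⟨stmt-QuantumFields-24336⟩, UNSTAFFED); ⟨24004⟩
⟨24336⟩ remain OPEN; route AllWindowsColdBox is DRAFT; no crux, rung or summit is proved; **the Yang–Mills mass gap is NOT proved by this file; no summit
is proved by a line.**
-/

set_option autoImplicit false

noncomputable section

open Matrix Finset
open Literature.Probability.LatticeModels (Site)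
open Literature.MathematicalPhysics.QuantumFieldTheory (Plaq)

namespace Summit.QuantumFields.YangMills.Theorems.AllWindowsColdBoxBoxHighLine

namespace Cum3Triangle

variable {H : ℕ}

/-- The ghost quadratic form is a symmetric matrix. -/
theorem ghostM_isSymm (H : ℕ) : (GhostFP.ghostM H).IsSymm :=
  Matrix.IsSymm.ext fun i j => GhostFP.ghostM_symm j i

/-- ★ **The ghost vertex**: `|κ₃⁰(linCurvSq p, linCurvSq q, quadVal M_H)| ≤ β⁻³·C·(1+log H)⁵/(1+‖p−q‖₁)⁴`. -/
theorem abs_gaussCum3_linCurvSq_linCurvSq_ghostM_le : ∃ C : ℝ, 0 ≤ C ∧ ∀ H : ℕ, 1 ≤ H → ∀ β : ℝ, 0 < β → ∀ p q : Plaq 4,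
    |gaussAvg β H (fun a => linCurvSq H p a * linCurvSq H q a * quadVal (GhostFP.ghostM H) a) -
        gaussAvg β H (linCurvSq H p) * gaussAvg β H (fun a => linCurvSq H q a * quadVal (GhostFP.ghostM H) a) -
        gaussAvg β H (linCurvSq H q) * gaussAvg β H (fun a => linCurvSq H p a * quadVal (GhostFP.ghostM H) a) -
        gaussAvg β H (quadVal (GhostFP.ghostM H)) * gaussAvg β H (fun a => linCurvSq H p a * linCurvSq H q a) +
        2 * (gaussAvg β H (linCurvSq H p) * gaussAvg β H (linCurvSq H q) * gaussAvg β H (quadVal (GhostFP.ghostM H)))| ≤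
      β⁻¹ ^ 3 * (C * (1 + Real.log H) ^ 5 / (1 + (((∑ m : Fin 4, |p.1 m - q.1 m|) : ℤ) : ℝ)) ^ 4) := by
  obtain ⟨C, hC0, h⟩ := abs_gaussCum3_linCurvSq_linCurvSq_quadVal_le
  obtain ⟨CG, hCG0, hG⟩ := GhostFP.abs_ghostM_le
  refine ⟨C * CG, by positivity, fun H hH β hβ p q => ?_⟩
  have h1 := h H hH β hβ CG hCG0 (GhostFP.ghostM H) (ghostM_isSymm H) (hG H hH) p q
  simpa only [mul_assoc] using h1

/-- A scalar multiple of the identity is symmetric. -/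
theorem smul_one_isSymm (m : ℝ) : (m • (1 : Matrix (LandauFree H × Fin 3) (LandauFree H × Fin 3) ℝ)).IsSymm :=
  (Matrix.isSymm_one).smul m

/-- A scalar multiple of the identity is a diagonal kernel: `|(m·1) i j| ≤ |m|/(1+d_∞(base i, base j))⁴`. -/
theorem abs_smul_one_apply_le (m : ℝ) (i j : LandauFree H × Fin 3) :
    |(m • (1 : Matrix (LandauFree H × Fin 3) (LandauFree H × Fin 3) ℝ)) i j| ≤ |m| / (1 + siteDist (i.1.1.1).1 (j.1.1.1).1) ^ 4 := by
  rw [Matrix.smul_apply, smul_eq_mul, abs_mul]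
  by_cases hij : i = j
  · subst hij
    have hz : siteDist (i.1.1.1).1 (i.1.1.1).1 = 0 := by
      have h0 : siteDist (i.1.1.1).1 (i.1.1.1).1 ≤ 0 := CubeTwoCentre.siteDist_le_of_forall _ _ fun k => by simp
      linarith [GhostKernel.siteDist_nonneg (i.1.1.1).1 (i.1.1.1).1]
    rw [hz, Matrix.one_apply_eq]; simp
  · rw [Matrix.one_apply_ne hij, abs_zero, mul_zero]
    have := GhostKernel.siteDist_nonneg (i.1.1.1).1 (j.1.1.1).1
    positivity

/-- ★ **A mass vertex**: `|κ₃⁰(linCurvSq p, linCurvSq q, quadVal (m·1))| ≤ β⁻³·C·|m|·(1+log H)⁵/(1+‖p−q‖₁)⁴`. -/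
theorem abs_gaussCum3_linCurvSq_linCurvSq_quadVal_smul_one_le : ∃ C : ℝ, 0 ≤ C ∧ ∀ H : ℕ, 1 ≤ H → ∀ β : ℝ, 0 < β → ∀ m : ℝ,
    ∀ p q : Plaq 4,
    |gaussAvg β H (fun a => linCurvSq H p a * linCurvSq H q a *
          quadVal (m • (1 : Matrix (LandauFree H × Fin 3) (LandauFree H × Fin 3) ℝ)) a) -
        gaussAvg β H (linCurvSq H p) * gaussAvg β H (fun a => linCurvSq H q a *
          quadVal (m • (1 : Matrix (LandauFree H × Fin 3) (LandauFree H × Fin 3) ℝ)) a) -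
        gaussAvg β H (linCurvSq H q) * gaussAvg β H (fun a => linCurvSq H p a *
          quadVal (m • (1 : Matrix (LandauFree H × Fin 3) (LandauFree H × Fin 3) ℝ)) a) -
        gaussAvg β H (quadVal (m • (1 : Matrix (LandauFree H × Fin 3) (LandauFree H × Fin 3) ℝ))) *
          gaussAvg β H (fun a => linCurvSq H p a * linCurvSq H q a) +
        2 * (gaussAvg β H (linCurvSq H p) * gaussAvg β H (linCurvSq H q) *
          gaussAvg β H (quadVal (m • (1 : Matrix (LandauFree H × Fin 3) (LandauFree H × Fin 3) ℝ))))| ≤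
      β⁻¹ ^ 3 * (C * |m| * (1 + Real.log H) ^ 5 / (1 + (((∑ k : Fin 4, |p.1 k - q.1 k|) : ℤ) : ℝ)) ^ 4) := by
  obtain ⟨C, hC0, h⟩ := abs_gaussCum3_linCurvSq_linCurvSq_quadVal_le
  refine ⟨C, hC0, fun H hH β hβ m p q => ?_⟩
  exact h H hH β hβ |m| (abs_nonneg m) _ (smul_one_isSymm m) (abs_smul_one_apply_le m) p q

end Cum3Triangle

end Summit.QuantumFields.YangMills.Theorems.AllWindowsColdBoxBoxHighLine

end
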